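import Summits.ResolutionOfSingularities.ResolutionOfSingularities.Theorems.EquisingularLiftEquisingularLiftNatFirstOrderPoints
import HarnessLib

/-!
# [OURS · tools] SUFFICIENT CONDITIONS FOR THE FIRST-ORDER CRITERION: ordinary points; a single singular direction of the tangent cone off `V(Ψ₁)`
# (cruxes `Theses.EquisingularLift.EquisingularLiftNat` / `…NatThree` / `EquisingularLift`, stmt-ResolutionOfSingularities-20038 / -20148 / -15660)

[OURS · leafhand-res-equisingularlift-9 g0, 2026-08-31; cell `pub/decomp-res`] AI-produced, weaker than expert review; NOT a statement of any manuscript;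
nothing here proves resolution of singularities.  DEF-FREE helper; no `sorry`; standard axioms; ZERO named hypotheses.

How to CHECK the first-order criterion (FO) of ✓ `FirstOrderPoint.exists_strictTransform` / the (fo) hypothesis of
✓ `FirstOrderPoint.elNatAt_of_firstOrderPoints_matrix₂`, ✓ `CubicNodes.elNatAt_of_cubic_firstOrder` at a given singular point:

* `FirstOrderPoint.firstOrder_of_isNonsingularForm` — ORDINARY points are first-order, whatever the next form `Ψ₁` (so leafhand-7/8's ordinary-point
  theorems are literal special cases of the first-order ones);
* `FirstOrderPoint.forall_aeval_of_singular_direction` — closed-point form: if the tangent cone `Φ` is singular (as a form: `Φ(z) = 0`, `∇Φ(z) = 0`) only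
  along ONE direction `K·v`, and the next form does not vanish there, `Ψ₁(v) ≠ 0`, then (fo) holds — the `A₂` surface points (`Φ` = two planes meeting
  along `K·v`, `Ψ₁(v) ≠ 0`) and their higher-dimensional analogues `y₀y₁ + q(y₂,…) + …`;
* `FirstOrderPoint.firstOrder_of_singular_direction` — the same in prime-ideal form over `K = K̄` (✓ `firstOrder_of_forall_aeval`).

References: [Hartshorne1977, I Ex. 5.8, II Ex. 7.12]; J. W. Bruce, C. T. C. Wall, *On the classification of cubic surfaces*, J. London Math. Soc. 19 (1979)
(the `A₂` recognition: rank-2 tangent cone, cubic term non-zero on its vertex line) — index only.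
-/

set_option linter.dupNamespace false -- mandated namespace `Summit.<Summit>.<Problem>` of this single-conjunct summit

noncomputable section

open MvPolynomial
open Literature.AlgebraicGeometry.Motives Literature.AlgebraicGeometry.Motives.SmoothHypersurface

namespace Summit.ResolutionOfSingularities.ResolutionOfSingularities.Cruxes.EquisingularLiftNat.Sections

namespace FirstOrderPoint

variable (K : Type) [Field K]

/-- **Ordinary points are first-order**: if the tangent cone `Φ` is a non-singular form, (FO) holds for every next form `Ψ₁`. [folklore] -/
theorem firstOrder_of_isNonsingularForm {n : ℕ} {Φ : MvPolynomial (Fin (n + 2)) K} (hns : IsNonsingularForm K Φ)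
    (Ψ₁ : MvPolynomial (Fin (n + 2)) K) (P : Ideal (MvPolynomial (Fin (n + 2)) K)) (hP : P.IsPrime) (hΦ : Φ ∈ P)
    (hd : ∀ i, pderiv i Φ ∈ P) (_hΨ : Ψ₁ ∈ P) (i : Fin (n + 2)) : (X i : MvPolynomial (Fin (n + 2)) K) ∈ P :=
  hns P hP hΦ hd i

/-- **A single singular direction of the tangent cone, off `V(Ψ₁)` — closed-point form.**  If every `z` with `Φ(z) = 0`, `∇Φ(z) = 0` is a multiple of
the fixed vector `v`, and the form `Ψ₁` of degree `μ + 1` satisfies `Ψ₁(v) ≠ 0`, then `Φ(z) = ∇Φ(z) = Ψ₁(z) = 0` only for `z = 0`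
(`Ψ₁(s·v) = s^{μ+1}·Ψ₁(v)`).  E.g. the `A₂` surface point `y₀y₁ + y₂³ + …`: `Φ = y₀y₁` is singular exactly along `K·e₂` and `Ψ₁(e₂) = 1`. [folklore] -/
theorem forall_aeval_of_singular_direction {n : ℕ} {Φ Ψ₁ : MvPolynomial (Fin n) K} {μ : ℕ} (hΨ₁ : Ψ₁.IsHomogeneous (μ + 1))
    (v : Fin n → K) (hdir : ∀ z : Fin n → K, aeval z Φ = 0 → (∀ i, aeval z (pderiv i Φ) = 0) → ∃ s : K, z = s • v)
    (hv : aeval v Ψ₁ ≠ 0) (z : Fin n → K) (h0 : aeval z Φ = 0) (hd : ∀ i, aeval z (pderiv i Φ) = 0) (hΨ : aeval z Ψ₁ = 0) : z = 0 := by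
  obtain ⟨s, rfl⟩ := hdir z h0 hd
  have hs : aeval (s • v) Ψ₁ = s ^ (μ + 1) * aeval v Ψ₁ := by
    rw [show (s • v : Fin n → K) = fun j => s * v j from funext fun j => by simp [Pi.smul_apply, smul_eq_mul]]
    exact Cone.aeval_smul_eq_pow_mul_aeval hΨ₁ s v
  rw [hs] at hΨ
  rcases mul_eq_zero.mp hΨ with h | h
  · rw [eq_zero_of_pow_eq_zero h, zero_smul]
  · exact absurd h hv

/-- **The same in prime-ideal form** over an algebraically closed field (✓ `firstOrder_of_forall_aeval`). [folklore] -/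
theorem firstOrder_of_singular_direction [IsAlgClosed K] {n : ℕ} {Φ Ψ₁ : MvPolynomial (Fin n) K} {μ : ℕ} (hΨ₁ : Ψ₁.IsHomogeneous (μ + 1))
    (v : Fin n → K) (hdir : ∀ z : Fin n → K, aeval z Φ = 0 → (∀ i, aeval z (pderiv i Φ) = 0) → ∃ s : K, z = s • v)
    (hv : aeval v Ψ₁ ≠ 0) (P : Ideal (MvPolynomial (Fin n) K)) (hP : P.IsPrime) (hΦ : Φ ∈ P) (hd : ∀ i, pderiv i Φ ∈ P) (hΨ : Ψ₁ ∈ P)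
    (i : Fin n) : (X i : MvPolynomial (Fin n) K) ∈ P :=
  firstOrder_of_forall_aeval K Φ Ψ₁ (forall_aeval_of_singular_direction K hΨ₁ v hdir hv) P hP hΦ hd hΨ i

/-- **The `A₂` recognition in closed-point form, every characteristic**: for `Φ = y₀y₁` in `K[y₀, y₁, y₂]` the vectors `z` with `Φ(z) = ∇Φ(z) = 0` are the
multiples of `e₂`; hence with any next form `Ψ₁` of degree `3` with `Ψ₁(e₂) ≠ 0` the point is first-order (`forall_aeval_of_singular_direction`). [folklore] -/
theorem singular_direction_A₂ (z : Fin 3 → K) (_h0 : aeval z (X 0 * X 1 : MvPolynomial (Fin 3) K) = 0)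
    (hd : ∀ i, aeval z (pderiv i (X 0 * X 1 : MvPolynomial (Fin 3) K)) = 0) : ∃ s : K, z = s • (Pi.single 2 1 : Fin 3 → K) := by
  have h1 : z 1 = 0 := by
    have h := hd 0
    rwa [pderiv_mul, pderiv_X_self, pderiv_X_of_ne (by decide : (1 : Fin 3) ≠ 0), one_mul, mul_zero, add_zero, aeval_X] at h
  have h0' : z 0 = 0 := by
    have h := hd 1
    rwa [pderiv_mul, pderiv_X_of_ne (by decide : (0 : Fin 3) ≠ 1), pderiv_X_self, zero_mul, zero_add, mul_one, aeval_X] at h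
  refine ⟨z 2, funext fun i => ?_⟩
  fin_cases i
  · simp [h0']
  · simp [h1]
  · simp

end FirstOrderPoint

end Summit.ResolutionOfSingularities.ResolutionOfSingularities.Cruxes.EquisingularLiftNat.Sections

end
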